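import Summits.QuantumFields.BalabanUV.Gaps.EndDrawdownEverySlopeDecided

/-!
# Gaps / EndDrawdownLinearRoad — the END statement over the LINEAR remainder class `|β¹_{k+1}(g_0,…,g_k)| ≤ C·g_k` on `]0,γ₀]` (the (AF-1)
# road of [I] (2.12)–(2.14) p. 268 ∕ [II] p. 8 after (1.29) «use the expression g_k|B| instead of ε₁», typed in the tree as the hypothesis shape of
# `CapSignsConstRoad.everySlope_of_af1`; a SUBCLASS of the every-slope realizations): FORCING HAS THE SAME THRESHOLD AS ON THE EVERY-SLOPE ROAD —
# `EndForcedLin b C γ₀ ⟺ ∃ r > 0, DwSeq b r ⟺ EndForcedES b γ₀` for every real `b`, every `C > 0`, every box — by the LINEAR adversary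
# `b_k − C g_k` and a 3∕2-POWER WINDOW INEQUALITY for SIGN-CHANGING `b` (gen 8's `EndDrawdownEverySlopeExact.window_pow_adv` had `b ≥ 0`; here the
# necessary `DwSeq b 0` replaces the sign), so the printed linear modulus buys NOTHING for forcing at END grade; POSSIBILITY on the linear road
# follows from a QUADRATIC drawdown profile (`M_b(Cγ∕2) ≤ 3∕γ²`, the barrier shooting lemma with help `C·g`), holds at the boundary of every
# drift class and for the harmonic tail `−1∕(j+1)` (so `DwSeq b 0 ⟹ POSSIBLE` is strict on the linear road too), and implies every-slope
# possibility; the two possibilities do NOT coincide (the companion `Gaps/EndDrawdownLinearRoadStrict`: a dyadic staircase possible on the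
# every-slope road and impossible on the linear road) (this seat's own leaf; cell pub-balaban-gaps, seat g1-p3 GEN 9, rows CAP ∕ tail ∕ (D4)
# «split ∕ weakening»; file 13 of «the one-loop interface of the END statement»)

HONEST FRAMING (cell rule, page 1 of everything): [folklore] window arithmetic along in-interval runs of forward-generated constructions + the
barrier shooting lemma of `Gaps/EndDrawdownCooperator`, for a TOY linear family on the tree's carrier; `EndForcedLin` ∕ `EndPossibleLin` are
quantified READINGS of the cell's END-grade statement over Bałaban-free data `(b, C, γ₀)`, not binders.  For Bałaban's split, (AF-1) with ONE
constant `C` uniform in the scale is NOT carried out in print (tree record `Beta.RemainderChain` §2, `CapSignsConstRoad` §1) — a located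
UNPRINTED currency of row (D4), like `EverySlope`; no constant, coefficient, slope or limit of Bałaban's table is certified (NODE-O 0∕1); words ∕
odds of rows CAP ∕ tail ∕ (D4) ∕ (D1) UNCHANGED.  Nothing of Bałaban's is asserted; 0∕6 binders; one finite T⁴; NOT [I] Thm 2, NOT `BetaPertH`,
NOT the continuum limit, NOT Clay.

CITATION HEADER (tags CONTEXT ONLY).  [I] = T. Bałaban, Commun. Math. Phys. **109** (1987) 249–301 [Balaban1987RG1]: (0.20) p. 256, Thm 2
p. 259 (first sentence), §1 p. 264, Thm 3 p. 264, (2.12)–(2.14) p. 268.  [II] = T. Bałaban, Commun. Math. Phys. **116** (1988) 1–22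
[Balaban1988RG2Cluster]: p. 8 after (1.29) (the linear alternative «g_k|B| instead of ε₁», quoted from the tree record `CapSignsConstRoad` §1).
-/

namespace Summit.QuantumFields.BalabanUV.Gaps.EndDrawdownLinearRoad

open Literature.MathematicalPhysics.QuantumFieldTheory.Balaban1983to89
open Literature.MathematicalPhysics.QuantumFieldTheory.Balaban1983to89.FlowStep
open Literature.MathematicalPhysics.QuantumFieldTheory.Balaban1983to89.FlowStepRuns
open Literature.MathematicalPhysics.QuantumFieldTheory.Balaban1983to89.DagBinding
open Literature.MathematicalPhysics.QuantumFieldTheory.Balaban1983to89.Beta.Drift (OneLoopDrift)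
open Literature.MathematicalPhysics.QuantumFieldTheory.Balaban1983to89.Beta.RateCertificate (CauchyRate)
open Literature.MathematicalPhysics.QuantumFieldTheory.Balaban1983to89.Beta.OneStepKernelFamily (TbalOf)
open Literature.MathematicalPhysics.QuantumFieldTheory.Balaban1983to89.Beta.AffineAveraging (box)
open Summit.QuantumFields.BalabanUV.Beta.MixedJetTablesPlug (JsBalAn1)
open Summit.QuantumFields.BalabanUV.Beta.GAN24.StencilSlotOfE3 (one_le_of_two_le)
open Summit.QuantumFields.BalabanUV.Gaps.CapSignsConstRoad (EverySlope everySlope_of_af1)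
open Summit.QuantumFields.BalabanUV.Gaps.CapSignsNecessaryFwd (windowSum_ge_of_forwardGenerated)
open Summit.QuantumFields.BalabanUV.Gaps.CapTailPinnedLimitSign (exists_geomRate_pinned)
open Summit.QuantumFields.BalabanUV.Gaps.EndDrawdownSeq
open Summit.QuantumFields.BalabanUV.Gaps.EndDrawdownBand
open Summit.QuantumFields.BalabanUV.Gaps.EndDrawdownEverySlope
open Summit.QuantumFields.BalabanUV.Gaps.EndDrawdownCooperator (run_of_bandBarrier)
open Summit.QuantumFields.BalabanUV.Gaps.EndDrawdownEverySlopeDecided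
open Filter Topology Finset

noncomputable section

variable {b : ℕ → ℝ}

/-! ## §1 The linear realization `β_{k+1} = b_k + c·g_k` and the quantified readings over the linear class -/

/-- THE LINEAR FAMILY · one-loop part `b`, remainder `c·g_k` on histories with positive last coupling (`0` at `g_k = 0`); `c = −C` the linear
ADVERSARY, `c = +C` the linear COOPERATOR.  A TOY on the tree's carrier. [folklore] -/
def betaLin (b : ℕ → ℝ) (c : ℝ) : HBeta := fun k p => b k + (if 0 < p (Fin.last k) then c * p (Fin.last k) else 0)

/-- Its printed split: `β⁰ := b`, `β¹ := c·g_k·𝟙[g_k > 0]`. [folklore] -/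
def splitLin (b : ℕ → ℝ) (c : ℝ) : B12Beta.OneLoopSplit (betaLin b c) where
  β0 := b
  β1 := fun k p => if 0 < p (Fin.last k) then c * p (Fin.last k) else 0
  split := fun _ _ => rfl
  vanish := fun k p hp => by simp [hp]

/-- On a history with positive last coupling: `β_{k+1} = b_k + c g_k`. [folklore] -/
theorem betaLin_of_pos (b : ℕ → ℝ) (c : ℝ) (k : ℕ) {p : Fin (k + 1) → ℝ} (hp : 0 < p (Fin.last k)) :
    betaLin b c k p = b k + c * p (Fin.last k) := by
  simp [betaLin, hp]

/-- (C) for the linear family on every box. [folklore] -/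
theorem betaContH_betaLin (b : ℕ → ℝ) (c γ : ℝ) : BetaContH γ (betaLin b c) := fun k =>
  (continuousOn_const.add (continuousOn_const.mul (continuous_apply (Fin.last k)).continuousOn)).congr
    fun _ hp => betaLin_of_pos b c k ((mem_box.mp hp) (Fin.last k)).1

/-- The linear family is (AF-1) with constant `|c|` on EVERY box: `|β¹_{k+1}(p)| ≤ |c|·p_k`. [cite: Balaban1987RG1, (2.12)–(2.14) p.268] -/
theorem af1_splitLin (b : ℕ → ℝ) (c γ : ℝ) (k : ℕ) (p : Fin (k + 1) → ℝ) (hp : p ∈ B12Beta.HistBox γ k) :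
    |(splitLin b c).β1 k p| ≤ |c| * p (Fin.last k) := by
  have hlast := (hp (Fin.last k)).1
  show |(if 0 < p (Fin.last k) then c * p (Fin.last k) else 0)| ≤ |c| * p (Fin.last k)
  rw [if_pos hlast, abs_mul, abs_of_pos hlast]

/-- QUANTIFIED READING (universal) over the LINEAR class · E for EVERY realization of `b` whose remainder satisfies (AF-1) with constant `C` on the
`]0,γ₀]`-histories, (C) on `]0,γ₀]`, any forward-generated construction.  A reading over Bałaban-free data `(b, C, γ₀)`; not a binder.
[cite: Balaban1987RG1, Thm 2 p.259 (first sentence) and (2.12)–(2.14) p.268] -/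
def EndForcedLin (b : ℕ → ℝ) (C γ₀ : ℝ) : Prop :=
  ∀ (β : HBeta) (Sβ : B12Beta.OneLoopSplit β) (Cn : B12.Construction), (∀ j, Sβ.β0 j = b j) →
    (∀ (k : ℕ) (p : Fin (k + 1) → ℝ), p ∈ B12Beta.HistBox γ₀ k → |Sβ.β1 k p| ≤ C * p (Fin.last k)) →
      BetaContH γ₀ β → ForwardGenerated Cn β → EndpointExistence Cn

/-- QUANTIFIED READING (existential) over the LINEAR class · SOME (AF-1)-realization of `(b, C, γ₀)` has E.
[cite: Balaban1987RG1, Thm 2 p.259 (first sentence) and (2.12)–(2.14) p.268] -/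
def EndPossibleLin (b : ℕ → ℝ) (C γ₀ : ℝ) : Prop :=
  ∃ (β : HBeta) (Sβ : B12Beta.OneLoopSplit β) (Cn : B12.Construction), (∀ j, Sβ.β0 j = b j) ∧
    (∀ (k : ℕ) (p : Fin (k + 1) → ℝ), p ∈ B12Beta.HistBox γ₀ k → |Sβ.β1 k p| ≤ C * p (Fin.last k)) ∧
      BetaContH γ₀ β ∧ ForwardGenerated Cn β ∧ EndpointExistence Cn

/-- The linear class sits inside the every-slope class: FORCED_ES ⟹ FORCED_Lin (`CapSignsConstRoad.everySlope_of_af1`; `0 ≤ C`, `0 < γ₀`).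
[cite: Balaban1987RG1, Thm 3 p.264 and (2.12)–(2.14) p.268] -/
theorem endForcedLin_of_endForcedES {C γ₀ : ℝ} (hC : 0 ≤ C) (hγ₀ : 0 < γ₀) (h : EndForcedES b γ₀) : EndForcedLin b C γ₀ :=
  fun _ Sβ _ hb hAF hcont hgen => h _ Sβ _ hb (everySlope_of_af1 Sβ hγ₀ hC hAF) hcont hgen

/-- … and POSSIBLE_Lin ⟹ POSSIBLE_ES. [cite: Balaban1987RG1, Thm 3 p.264 and (2.12)–(2.14) p.268] -/
theorem endPossibleES_of_endPossibleLin {C γ₀ : ℝ} (hC : 0 ≤ C) (hγ₀ : 0 < γ₀) (h : EndPossibleLin b C γ₀) : EndPossibleES b γ₀ := by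
  obtain ⟨β, Sβ, Cn, hb, hAF, hcont, hgen, hE⟩ := h
  exact ⟨β, Sβ, Cn, hb, everySlope_of_af1 Sβ hγ₀ hC hAF, hcont, hgen, hE⟩

/-! ## §2 The 3∕2-power window inequality for SIGN-CHANGING one-loop parts along the linear adversary -/

/-- **THE 3∕2-POWER WINDOW INEQUALITY, SIGN-FREE** · `b` with bounded drawdown below the `0`-line (bound `M₀`), the linear adversary `b_k − c g_k`
(`c > 0`), a run of ANY forward-generated construction in a box up to `n` ending at `g_n = g⋆`: for every `k ≤ n`,
`c·(n − k) ≤ √(1∕g⋆² + M₀ + Σ_{[k,n)} b)³` — backward `1∕g_j² ≤ 1∕g⋆² + Σ_{[j,n)} b ≤ t²` (suffix sums differ from the full window by `≤ M₀`),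
forward `c·Σ_{[k,n)} g_j ≤ 1∕g⋆² + Σ_{[k,n)} b ≤ t²`, count `(n−k)∕t ≤ Σ g`.  The realised window INEQUALITY suffices (no `HaltsOutside`).
[cite: Balaban1987RG1, (0.20) p.256] -/
theorem window_pow_lin {c M₀ : ℝ} (hc : 0 < c) (hM₀ : ∀ k n : ℕ, k ≤ n → -M₀ ≤ ∑ j ∈ Finset.Ico k n, b j)
    {Cn : B12.Construction} (hgen : ForwardGenerated Cn (betaLin b (-c))) (P : B12.RunParams) {γ gstar : ℝ}
    (hI : (Cn P).flow.InInterval γ P.K) (hend : (Cn P).flow.g P.K = gstar) {k : ℕ} (hk : k ≤ P.K) :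
    c * (((P.K : ℕ) : ℝ) - k) ≤ Real.sqrt (1 / gstar ^ 2 + M₀ + ∑ i ∈ Finset.Ico k P.K, b i) ^ 3 := by
  have hM00 : 0 ≤ M₀ := by have h := hM₀ 0 0 le_rfl; simp at h; linarith
  have hgpos : ∀ j, j ≤ P.K → 0 < (Cn P).flow.g j := fun j hj => (hI j hj).1
  have hgs : 0 < gstar := by rw [← hend]; exact hgpos _ le_rfl
  -- realised window inequality, rewritten for the linear adversary
  have hwin : ∀ j, j ≤ P.K → 1 / ((Cn P).flow.g j) ^ 2 - 1 / gstar ^ 2 ≤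
      ∑ i ∈ Finset.Ico j P.K, b i - c * ∑ i ∈ Finset.Ico j P.K, (Cn P).flow.g i := by
    intro j hj
    have h := windowSum_ge_of_forwardGenerated hgen P hI hj le_rfl
    rw [hend] at h
    have hterm : ∀ i ∈ Finset.Ico j P.K, betaLin b (-c) i (prefixOf (Cn P).flow.g i) = b i - c * (Cn P).flow.g i :=
      fun i hi => by
        rw [betaLin_of_pos b (-c) i (by simpa using hgpos i (Finset.mem_Ico.mp hi).2.le)]
        simp only [prefixOf_apply, Fin.val_last]
        ring
    rw [Finset.sum_congr rfl hterm, Finset.sum_sub_distrib, ← Finset.mul_sum] at h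
    exact h
  set S : ℝ := ∑ i ∈ Finset.Ico k P.K, b i with hS
  have hsumg_nonneg : ∀ j, 0 ≤ ∑ i ∈ Finset.Ico j P.K, (Cn P).flow.g i := fun j =>
    Finset.sum_nonneg fun i hi => (hgpos i (Finset.mem_Ico.mp hi).2.le).le
  -- T² := 1/g⋆² + M₀ + S > 0
  have hk0 : 0 < 1 / ((Cn P).flow.g k) ^ 2 := one_div_pos.mpr (pow_pos (hgpos k hk) 2)
  have hT2 : 0 < 1 / gstar ^ 2 + M₀ + S := by
    have h := hwin k hk
    nlinarith [hsumg_nonneg k, mul_nonneg hc.le (hsumg_nonneg k)]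
  set t : ℝ := Real.sqrt (1 / gstar ^ 2 + M₀ + S) with ht
  have ht0 : 0 < t := Real.sqrt_pos.mpr hT2
  have htsq : t ^ 2 = 1 / gstar ^ 2 + M₀ + S := Real.sq_sqrt hT2.le
  -- backward bound on the window: 1/g_j² ≤ t²
  have hback : ∀ j ∈ Finset.Ico k P.K, 1 / ((Cn P).flow.g j) ^ 2 ≤ t ^ 2 := by
    intro j hj
    have hkj : k ≤ j := (Finset.mem_Ico.mp hj).1
    have hjn : j ≤ P.K := (Finset.mem_Ico.mp hj).2.le
    have hw := hwin j hjn
    have hsplit := Finset.sum_Ico_consecutive b hkj hjn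
    have hpre := hM₀ k j hkj
    rw [htsq]
    nlinarith [mul_nonneg hc.le (hsumg_nonneg j)]
  -- hence t·g_j ≥ 1 on the window
  have htg : ∀ j ∈ Finset.Ico k P.K, (1 : ℝ) ≤ t * (Cn P).flow.g j := by
    intro j hj
    have hgj := hgpos j (Finset.mem_Ico.mp hj).2.le
    have h1 : 1 ≤ t ^ 2 * ((Cn P).flow.g j) ^ 2 := by
      have := hback j hj
      rwa [div_le_iff₀ (pow_pos hgj 2)] at this
    nlinarith [mul_nonneg ht0.le hgj.le, h1]
  -- forward bound: c Σ g ≤ t²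
  have hfwd : c * ∑ i ∈ Finset.Ico k P.K, (Cn P).flow.g i ≤ t ^ 2 := by
    have hw := hwin k hk
    rw [htsq]
    linarith
  -- count
  have hcount : (((P.K : ℕ) : ℝ) - k) ≤ t * ∑ i ∈ Finset.Ico k P.K, (Cn P).flow.g i := by
    rw [Finset.mul_sum]
    have h := Finset.sum_le_sum htg
    rw [Finset.sum_const, Nat.card_Ico, nsmul_eq_mul, mul_one, Nat.cast_sub hk] at h
    exact h
  calc c * (((P.K : ℕ) : ℝ) - k) ≤ c * (t * ∑ i ∈ Finset.Ico k P.K, (Cn P).flow.g i) := mul_le_mul_of_nonneg_left hcount hc.le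
    _ = t * (c * ∑ i ∈ Finset.Ico k P.K, (Cn P).flow.g i) := by ring
    _ ≤ t * t ^ 2 := mul_le_mul_of_nonneg_left hfwd ht0.le
    _ = t ^ 3 := by ring

/-- **WINDOW COUNTING, SIGN-FREE** · `b` with bounded drawdown below the `0`-line (bound `M₀`), `C₀ ≥ 0`, `c > 0`, and EVERY window satisfying
`c·(n − k) ≤ √(C₀ + Σ_{[k,n)} b)³`: then every window of length `m₀ := ⌈√(C₀+1)³ ∕ c⌉₊ + 1` carries mass `≥ 1`, `q` consecutive ones `≥ q`, a
remainder `≥ −M₀`, hence `DwSeq b (1∕m₀)` — a POSITIVE drawdown threshold (gen 8's `dwSeq_pos_of_windowGrowth` minus the sign of `b`). [folklore] -/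
theorem dwSeq_pos_of_windowGrowth_dwSeq_zero {c M₀ C₀ : ℝ} (hc : 0 < c) (hM₀ : ∀ k n : ℕ, k ≤ n → -M₀ ≤ ∑ j ∈ Finset.Ico k n, b j)
    (hC₀ : 0 ≤ C₀) (h : ∀ k n : ℕ, k ≤ n → c * ((n : ℝ) - k) ≤ Real.sqrt (C₀ + ∑ j ∈ Finset.Ico k n, b j) ^ 3) :
    ∃ r : ℝ, 0 < r ∧ DwSeq b r := by
  set m₀ : ℕ := ⌈Real.sqrt (C₀ + 1) ^ 3 / c⌉₊ + 1 with hm₀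
  have hm₀pos : 0 < m₀ := Nat.succ_pos _
  have hm₀R : Real.sqrt (C₀ + 1) ^ 3 < c * (m₀ : ℝ) := by
    have h1 : Real.sqrt (C₀ + 1) ^ 3 / c < (m₀ : ℝ) := by
      rw [hm₀]; push_cast
      exact (Nat.le_ceil _).trans_lt (lt_add_one _)
    rwa [div_lt_iff₀ hc, mul_comm] at h1
  -- every window of length m₀ carries mass ≥ 1
  have hblock : ∀ k : ℕ, 1 ≤ ∑ j ∈ Finset.Ico k (k + m₀), b j := by
    intro k
    refine le_of_not_gt fun hlt => ?_
    have hw := h k (k + m₀) (Nat.le_add_right _ _)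
    have hL : ((k + m₀ : ℕ) : ℝ) - k = m₀ := by push_cast; ring
    rw [hL] at hw
    have hpow : Real.sqrt (C₀ + ∑ j ∈ Finset.Ico k (k + m₀), b j) ^ 3 ≤ Real.sqrt (C₀ + 1) ^ 3 :=
      pow_le_pow_left₀ (Real.sqrt_nonneg _) (Real.sqrt_le_sqrt (by linarith)) 3
    linarith
  -- q consecutive blocks carry mass ≥ q
  have hblocks : ∀ q k : ℕ, (q : ℝ) ≤ ∑ j ∈ Finset.Ico k (k + q * m₀), b j := by
    intro q
    induction q with
    | zero => intro k; simp
    | succ q ih =>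
      intro k
      have h2 : k + (q + 1) * m₀ = (k + q * m₀) + m₀ := by ring
      have hsplit := Finset.sum_Ico_consecutive b (Nat.le_add_right k (q * m₀))
        (by rw [h2]; exact Nat.le_add_right _ _ : k + q * m₀ ≤ k + (q + 1) * m₀)
      rw [← hsplit, h2]
      push_cast
      linarith [ih k, hblock (k + q * m₀)]
  have hM00 : 0 ≤ M₀ := by have h0 := hM₀ 0 0 le_rfl; simp at h0; linarith
  refine ⟨1 / m₀, by positivity, M₀ + 1, fun k n hkn => ?_⟩
  obtain ⟨L, rfl⟩ := Nat.exists_eq_add_of_le hkn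
  have hqle : L / m₀ * m₀ ≤ L := Nat.div_mul_le_self L m₀
  have hLlt : L < (L / m₀ + 1) * m₀ := by
    have h3 : (L / m₀ + 1) * m₀ = m₀ * (L / m₀) + m₀ := by ring
    rw [h3]
    have hdm := Nat.div_add_mod L m₀
    have hml := Nat.mod_lt L hm₀pos
    omega
  have hsplit := Finset.sum_Ico_consecutive b (Nat.le_add_right k (L / m₀ * m₀)) (by omega : k + L / m₀ * m₀ ≤ k + L)
  have hrest := hM₀ (k + L / m₀ * m₀) (k + L) (by omega)
  have hmain := hblocks (L / m₀) k
  rw [sum_Ico_sub_const b (1 / m₀) hkn]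
  have hm₀R0 : (0 : ℝ) < m₀ := by exact_mod_cast hm₀pos
  have hLq : ((k + L : ℕ) : ℝ) - k = L := by push_cast; ring
  rw [hLq]
  have hLlt' : (L : ℝ) < ((L / m₀ : ℕ) + 1 : ℝ) * m₀ := by exact_mod_cast hLlt
  have hdiv : 1 / (m₀ : ℝ) * L ≤ (L / m₀ : ℕ) + 1 := by
    rw [one_div_mul_eq_div, div_le_iff₀ hm₀R0]
    exact hLlt'.le
  linarith

/-- **THE LINEAR ADVERSARY KILLS THE END WITHOUT A POSITIVE DRAWDOWN THRESHOLD** · `DwSeq b 0` and `EndpointExistence` of SOME forward-generated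
construction of `b_k − c g_k` (`c > 0`) ⟹ `∃ r > 0, DwSeq b r`. [cite: Balaban1987RG1, (0.20) p.256 and Thm 2 p.259 (first sentence)] -/
theorem dwSeq_pos_of_endpointExistence_lin {c : ℝ} (hc : 0 < c) (h0 : DwSeq b 0) {Cn : B12.Construction}
    (hgen : ForwardGenerated Cn (betaLin b (-c))) (hE : EndpointExistence Cn) : ∃ r : ℝ, 0 < r ∧ DwSeq b r := by
  obtain ⟨M₀, hM00, hM₀⟩ := h0.exists_nonneg
  have hM₀' : ∀ k n : ℕ, k ≤ n → -M₀ ≤ ∑ j ∈ Finset.Ico k n, b j := fun k n hkn => by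
    have h := hM₀ k n hkn; simpa using h
  obtain ⟨γ₂, hγ₂, hγ⟩ := hE 0
  obtain ⟨gstar, hgstar, hg⟩ := hγ γ₂ hγ₂ le_rfl
  have hrun := hg gstar hgstar le_rfl
  refine dwSeq_pos_of_windowGrowth_dwSeq_zero hc hM₀' (C₀ := 1 / gstar ^ 2 + M₀) (by positivity) fun k n hkn => ?_
  obtain ⟨g0, hI, hend⟩ := hrun n
  exact window_pow_lin hc hM₀' hgen ⟨n, 0, g0⟩ hI hend hkn

/-! ## §3 FORCING ON THE LINEAR ROAD HAS THE EVERY-SLOPE THRESHOLD -/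

/-- **THEOREM · `EndForcedLin b C γ₀ ⟺ ∃ r > 0, DwSeq b r`** for EVERY real sequence `b`, every `C > 0`, every box `0 < γ₀`.  ⟸: the every-slope
sufficiency (gen 8) restricted to the subclass; ⟹: the zero remainder (in the class) gives `DwSeq b 0`, the linear adversary `b − C g_k` (in the
class, (AF-1) with constant `C`) gives the 3∕2-power window inequality, whence a positive threshold. [cite: Balaban1987RG1, Thm 2 p.259 (first sentence) and (2.12)–(2.14) p.268] -/
theorem endForcedLin_iff_dwSeq_pos {C γ₀ : ℝ} (hC : 0 < C) (hγ₀ : 0 < γ₀) : EndForcedLin b C γ₀ ↔ ∃ r : ℝ, 0 < r ∧ DwSeq b r := by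
  refine ⟨fun hF => ?_, fun ⟨_, hr, hDw⟩ => endForcedLin_of_endForcedES hC.le hγ₀ (endForcedES_of_dwSeq_pos hr hDw)⟩
  have h0 : DwSeq b 0 := by
    have hE0 := hF _ (splitShift b 0) _ (fun _ => rfl) (fun k p hp => by
        show |(if 0 < p (Fin.last k) then (0 : ℝ) else 0)| ≤ C * p (Fin.last k)
        rw [if_pos (hp (Fin.last k)).1, abs_zero]
        exact mul_nonneg hC.le (hp (Fin.last k)).1.le)
      (betaContH_betaShift b 0 γ₀) (modelOf_forwardGenerated _)
    simpa using dwSeq_of_endpointExistence_betaShift (modelOf_forwardGenerated _) hE0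
  have hE := hF _ (splitLin b (-C)) _ (fun _ => rfl) (fun k p hp => by
      have h := af1_splitLin b (-C) γ₀ k p hp; rwa [abs_neg, abs_of_pos hC] at h)
    (betaContH_betaLin b (-C) γ₀) (modelOf_forwardGenerated _)
  exact dwSeq_pos_of_endpointExistence_lin hC h0 (modelOf_forwardGenerated _) hE

/-- **FORCING: THE LINEAR ROAD = THE EVERY-SLOPE ROAD** (`C > 0`, `0 < γ₀`): `EndForcedLin b C γ₀ ⟺ EndForcedES b γ₀` — the printed linear modulus
`|β¹| ≤ C g_k` does not lower the END-grade forcing threshold, for ANY one-loop sequence. [cite: Balaban1987RG1, Thm 3 p.264 and (2.12)–(2.14) p.268] -/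
theorem endForcedLin_iff_endForcedES {C γ₀ : ℝ} (hC : 0 < C) (hγ₀ : 0 < γ₀) : EndForcedLin b C γ₀ ↔ EndForcedES b γ₀ := by
  rw [endForcedLin_iff_dwSeq_pos hC hγ₀, endForcedES_iff_dwSeq_pos hγ₀]

/-- FORCING on the linear road depends neither on the constant nor on the box (`C, C′ > 0`, `γ₀, γ₀′ > 0`). [folklore] -/
theorem endForcedLin_free {C C' γ₀ γ₀' : ℝ} (hC : 0 < C) (hC' : 0 < C') (hγ₀ : 0 < γ₀) (hγ₀' : 0 < γ₀') :
    EndForcedLin b C γ₀ ↔ EndForcedLin b C' γ₀' := by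
  rw [endForcedLin_iff_dwSeq_pos hC hγ₀, endForcedLin_iff_dwSeq_pos hC' hγ₀']

/-- IN A DRIFT CLASS: FORCED on the linear road ⟺ `0 < L`; at a CONVERGENT one-loop part ⟺ `0 < lim` (both sign-hypothesis-free).
[cite: Balaban1987RG1, Thm 2 p.259 (first sentence) and (1.22) p.264] -/
theorem endForcedLin_iff_slope_pos {C γ₀ L A : ℝ} (hC : 0 < C) (hγ₀ : 0 < γ₀) (hA : OneLoopDrift L A b) : EndForcedLin b C γ₀ ↔ 0 < L := by
  rw [endForcedLin_iff_endForcedES hC hγ₀, endForcedES_iff_slope_pos hγ₀ hA]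

/-- … convergent one-loop part. [cite: Balaban1987RG1, Thm 2 p.259 (first sentence) and (1.22) p.264] -/
theorem endForcedLin_iff_lim_pos {C γ₀ binf : ℝ} (hC : 0 < C) (hγ₀ : 0 < γ₀) (hlim : Tendsto b atTop (𝓝 binf)) :
    EndForcedLin b C γ₀ ↔ 0 < binf := by
  rw [endForcedLin_iff_endForcedES hC hγ₀, endForcedES_iff_lim_pos hγ₀ hlim]

/-- AT THE β-LEAD's PINNED LITERAL, HYPOTHESIS-FREE: FORCED on the linear road ⟺ `0 < M∞`. [cite: Balaban1987RG1, Thm 2 p.259 (first sentence) and (1.22) p.264] -/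
theorem endForcedLin_pinned_iff {Lc : ℕ} [NeZero Lc] (hLc : 2 ≤ Lc) {r : Fin (3 + 1) → ℕ} (hr : r ∈ box (3 + 1) Lc) (cE cVH cΛ cB : ℝ)
    (Tc : Fin 4 → Fin 4 → Fin 4 → Fin 4 → ℝ) (μ ν : Fin 4) {C γ₀ : ℝ} (hC : 0 < C) (hγ₀ : 0 < γ₀) :
    EndForcedLin (fun j => B12Beta.secondMoment
        (TbalOf Lc (JsBalAn1 (one_le_of_two_le hLc) hr cE cVH cΛ ((Lc : ℝ) ^ (2 * (3 + 1))) cB Tc) j) μ ν) C γ₀ ↔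
      0 < CauchyRate.lim fun j =>
        B12Beta.secondMoment (TbalOf Lc (JsBalAn1 (one_le_of_two_le hLc) hr cE cVH cΛ ((Lc : ℝ) ^ (2 * (3 + 1))) cB Tc) j) μ ν := by
  rw [endForcedLin_iff_endForcedES hC hγ₀]
  exact endForcedES_pinned_iff hLc hr cE cVH cΛ cB Tc μ ν hγ₀

/-! ## §4 POSSIBILITY ON THE LINEAR ROAD: a quadratic drawdown profile suffices; necessity is the every-slope one -/

/-- **THE LINEAR COOPERATOR FROM A QUADRATIC DRAWDOWN PROFILE** · if for every small box `γ ≤ γ₁` the drawdown of `b` below the line of slope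
`−Cγ∕2` is at most `3∕γ²` (`M_b(ε) ≤ 3C²∕(4ε²)` in the threshold `ε = Cγ∕2`), then EVERY forward-generated construction of `b_k + C g_k` (`C > 0`)
has `EndpointExistence` (`γ₂ = γ₁`, `g⋆ = γ∕2`; the barrier shooting lemma with help `C·g ≥ Cγ∕2` on the band `[γ∕2, γ]`).
[cite: Balaban1987RG1, Thm 2 p.259 (first sentence) and (0.20) p.256] -/
theorem endpointExistence_linCoop {C γ₁ : ℝ} (hC : 0 < C) (hγ₁ : 0 < γ₁)
    (hq : ∀ γ : ℝ, 0 < γ → γ ≤ γ₁ → ∃ M : ℝ, M ≤ 3 / γ ^ 2 ∧ ∀ k m : ℕ, k ≤ m → -M ≤ ∑ j ∈ Finset.Ico k m, (b j + C * γ / 2))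
    {Cn : B12.Construction} (hgen : ForwardGenerated Cn (betaLin b C)) : EndpointExistence Cn := by
  intro m
  refine ⟨γ₁, hγ₁, fun γ hγ hγle => ⟨γ / 2, by positivity, fun g hg hgle K => ?_⟩⟩
  obtain ⟨M, hM3, hM⟩ := hq γ hγ hγle
  exact run_of_bandBarrier (b := b) (H := fun x => C * x) (Hmax := C * γ) (ε := C * γ / 2)
    (fun k p hp => betaLin_of_pos b C k hp) (betaContH_betaLin b C γ) hγ
    (fun x _ hx => mul_le_mul_of_nonneg_left hx hC.le) (fun x hx _ => by nlinarith) hM hM3 hgen hg hgle K m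

/-- … hence POSSIBLE on the linear road with constant `C` on every box. [cite: Balaban1987RG1, Thm 2 p.259 (first sentence) and (2.12)–(2.14) p.268] -/
theorem endPossibleLin_of_quadraticProfile {C γ₁ γ₀ : ℝ} (hC : 0 < C) (hγ₁ : 0 < γ₁)
    (hq : ∀ γ : ℝ, 0 < γ → γ ≤ γ₁ → ∃ M : ℝ, M ≤ 3 / γ ^ 2 ∧ ∀ k m : ℕ, k ≤ m → -M ≤ ∑ j ∈ Finset.Ico k m, (b j + C * γ / 2)) :
    EndPossibleLin b C γ₀ :=
  ⟨betaLin b C, splitLin b C, modelOf (betaLin b C), fun _ => rfl,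
    fun k p hp => by have h := af1_splitLin b C γ₀ k p hp; rwa [abs_of_pos hC] at h,
    betaContH_betaLin b C γ₀, modelOf_forwardGenerated _, endpointExistence_linCoop hC hγ₁ hq (modelOf_forwardGenerated _)⟩

/-- `DwSeq b 0 ⟹` POSSIBLE on the linear road (the zero remainder; any `C ≥ 0`, `0 < γ₀`). [cite: Balaban1987RG1, Thm 2 p.259 (first sentence)] -/
theorem endPossibleLin_of_dwSeq_zero {C γ₀ : ℝ} (hC : 0 ≤ C) (hγ₀ : 0 < γ₀) (h0 : DwSeq b 0) : EndPossibleLin b C γ₀ :=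
  ⟨betaShift b 0, splitShift b 0, modelOf (betaShift b 0), fun _ => rfl,
    fun k p hp => by
      show |(if 0 < p (Fin.last k) then (0 : ℝ) else 0)| ≤ C * p (Fin.last k)
      rw [if_pos (hp (Fin.last k)).1, abs_zero]
      exact mul_nonneg hC (hp (Fin.last k)).1.le,
    betaContH_betaShift b 0 γ₀, modelOf_forwardGenerated _,
    endpointExistence_of_dwSeq_remainderConst (modelOf_forwardGenerated _) (splitShift b 0) hγ₀ h0
      (remainderConst_splitShift b abs_zero.le γ₀) (betaContH_betaShift b 0 γ₀)⟩

/-- NECESSITY is the every-slope one: POSSIBLE on the linear road ⟹ `∀ ε > 0, DwSeq b (−ε)` (`0 ≤ C`, `0 < γ₀`).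
[cite: Balaban1987RG1, (0.20) p.256 and Thm 2 p.259] -/
theorem dwSeq_neg_of_endPossibleLin {C γ₀ : ℝ} (hC : 0 ≤ C) (hγ₀ : 0 < γ₀) (h : EndPossibleLin b C γ₀) {ε : ℝ} (hε : 0 < ε) :
    DwSeq b (-ε) :=
  dwSeq_neg_of_endPossibleES (endPossibleES_of_endPossibleLin hC hγ₀ h) hε

/-- IN A DRIFT CLASS THE LINEAR ROAD AND THE EVERY-SLOPE ROAD COINCIDE: POSSIBLE_Lin ⟺ `0 ≤ L` ⟺ POSSIBLE_ES (boundary INCLUDED: `DwSeq b L`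
holds in the class), FORCED_Lin ⟺ `0 < L` ⟺ FORCED_ES (`C > 0`, `0 < γ₀`). [cite: Balaban1987RG1, Thm 2 p.259 (first sentence) and (1.22) p.264] -/
theorem endPossibleLin_iff_slope_nonneg {C γ₀ L A : ℝ} (hC : 0 < C) (hγ₀ : 0 < γ₀) (hA : OneLoopDrift L A b) :
    EndPossibleLin b C γ₀ ↔ 0 ≤ L := by
  refine ⟨fun h => (endPossibleES_iff_of_oneLoopDrift hγ₀ hA).mp (endPossibleES_of_endPossibleLin hC.le hγ₀ h), fun hL => ?_⟩
  exact endPossibleLin_of_dwSeq_zero hC.le hγ₀ (dwSeq_of_oneLoopDrift hA hL)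

/-- THE HARMONIC TAIL IS POSSIBLE ON THE LINEAR ROAD TOO · `b_j = −1∕(j+1)`: its drawdown below the line of slope `−ε` is `≤ 1∕ε + 1` (only
the `⌈1∕ε⌉` terms with `1∕(j+1) > ε` contribute, each `≥ −1`), a quadratic profile for `γ ≤ min 1 C`; so `EndPossibleLin b C γ₀` although
`¬ DwSeq b 0` — on the linear road as on the every-slope road, `DwSeq b 0 ⟹ POSSIBLE` does not reverse. [folklore] -/
theorem endPossibleLin_harmonic {C : ℝ} (hC : 0 < C) (γ₀ : ℝ) :
    EndPossibleLin (fun j : ℕ => (0 : ℝ) - 1 / ((j : ℝ) + 1)) C γ₀ ∧ ¬ DwSeq (fun j : ℕ => (0 : ℝ) - 1 / ((j : ℝ) + 1)) 0 := by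
  refine ⟨endPossibleLin_of_quadraticProfile (γ₁ := min 1 C) hC (lt_min one_pos hC) fun γ hγ hγle => ?_, not_dwSeq_harmonicBelow 0⟩
  have hγ1 : γ ≤ 1 := hγle.trans (min_le_left _ _)
  have hγC : γ ≤ C := hγle.trans (min_le_right _ _)
  set ε : ℝ := C * γ / 2 with hε
  have hεpos : 0 < ε := by positivity
  set N : ℕ := ⌈1 / ε⌉₊ with hN
  have hNlt : (N : ℝ) < 1 / ε + 1 := Nat.ceil_lt_add_one (by positivity)
  refine ⟨1 / ε + 1, ?_, fun k m hkm => ?_⟩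
  · -- 1/ε + 1 = 2/(Cγ) + 1 ≤ 3/γ² for γ ≤ min 1 C
    have h1 : 1 / ε = 2 / (C * γ) := by rw [hε]; field_simp
    rw [h1, div_add_one (by positivity), div_le_div_iff₀ (by positivity) (pow_pos hγ 2)]
    have hCγ : 0 < C * γ := by positivity
    nlinarith [mul_le_mul_of_nonneg_left hγ1 hCγ.le, mul_le_mul_of_nonneg_right hγC hγ.le]
  · have hterm : ∀ j : ℕ, -(if j < N then (1 : ℝ) else 0) ≤ (0 : ℝ) - 1 / ((j : ℝ) + 1) + ε := by
      intro j
      split_ifs with hj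
      · have : 1 / ((j : ℝ) + 1) ≤ 1 := by rw [div_le_one (by positivity)]; linarith [(Nat.cast_nonneg j : (0 : ℝ) ≤ j)]
        linarith
      · have hjN : (N : ℝ) ≤ j := by exact_mod_cast not_lt.mp hj
        have h1 : 1 / ε ≤ (j : ℝ) + 1 := by linarith [Nat.le_ceil (1 / ε)]
        have h2 : 1 / ((j : ℝ) + 1) ≤ ε := by
          rw [one_div_le (by positivity) hεpos]; exact h1
        linarith
    have hsum : -(∑ j ∈ Finset.Ico k m, (if j < N then (1 : ℝ) else 0)) ≤ ∑ j ∈ Finset.Ico k m, ((0 : ℝ) - 1 / ((j : ℝ) + 1) + ε) := by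
      rw [← Finset.sum_neg_distrib]; exact Finset.sum_le_sum fun j _ => hterm j
    have hcount : ∑ j ∈ Finset.Ico k m, (if j < N then (1 : ℝ) else 0) ≤ N := by
      rw [Finset.sum_ite, Finset.sum_const_zero, add_zero, Finset.sum_const, nsmul_eq_mul, mul_one]
      have hc : ((Finset.Ico k m).filter (fun j => j < N)).card ≤ N :=
        calc ((Finset.Ico k m).filter (fun j => j < N)).card ≤ (Finset.range N).card :=
              Finset.card_le_card fun j hj => by
                simp only [Finset.mem_filter, Finset.mem_Ico, Finset.mem_range] at hj ⊢
                exact hj.2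
          _ = N := Finset.card_range N
      exact_mod_cast hc
    linarith

end

end Summit.QuantumFields.BalabanUV.Gaps.EndDrawdownLinearRoad
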